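import Literature.MathematicalPhysics.QuantumFieldTheory.BlockScaleEffectivePerturbation
import Literature.MathematicalPhysics.QuantumLattice.HeatKernelGroup
import HarnessLib

/-!
# Bałaban's gauge-covariant block averaging at an arbitrary block size, with a soft last step

Definition request `defn-BalabanSoftAveraging` (crux `RobustYangMills`, line
`soft-absorption-balaban-cone`; also route `HeavyThresholdYMBridge`): ONE step of Bałaban's
gauge-covariant block averaging of a lattice `G`-gauge field on the discrete torus `(ℤ/Nℤ)^d` at an
ARBITRARY block size `b ≥ 1` — the torus side `N` need not be divisible by `b`, the last block in each
direction is then ragged (side `N - (⌈N/b⌉ - 1) b ≤ b`) — followed by a SOFT last step, a continuous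
central probability density `p` on `G` smearing each block link (intended: the heat kernel `p_t`).

## Content

1. **Block geometry at block size `b` on the torus of side `N`** (namespace `BalabanAveraging`):
   the block torus has side `blockSide N b = ⌈N / b⌉`; the block labelled by the block-torus site `y`
   is represented by its base corner `corner N b y = (b y₁, …, b y_d)` (representatives
   `yᵢ ∈ {0, …, ⌈N/b⌉ - 1}`; Bałaban's blocks `B(y) = {x : y_μ ≤ x_μ < y_μ + L η}` ARE labelled by
   their smallest corner, CMP 98 (1985) p. 17 (2)); its side in direction `i` is
   `width N b y i = min b (N - b yᵢ)` (`= b` except for the ragged last block); consecutive corners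
   satisfy `corner (y + e_μ) = corner y + width(y, μ) e_μ` on the torus (`corner_shift_eq`), also
   across the seam. `corner` is a bijection onto the tree's `blockCorners b` (`corner_injective`,
   `corner_mem_blockCorners`, `exists_corner_eq`), i.e. onto the labels of the tree's cubes
   `blockCorner b` (file `QuasiLocalGaugePerturbation`).
2. **Bałaban's contour variables** `contourVar N b U (y, μ) v = U(Γ_{c,x})`, `x = corner y + v`,
   `v ∈ {0, …, b-1}^d`: the parallel transporter along the contour
   `Γ_{c,x} = Γ_{c₋,x} ∪ [x, x(c)] ∪ Γ_{x(c),c₊}` from the corner `c₋ = corner y` along the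
   coordinate-ordered taxi path to `x`, then STRAIGHT in direction `μ` for `width(y, μ)` steps to
   `x(c) = x + width(y,μ) e_μ`, then back along the taxi path of the next block to its corner
   `c₊ = corner (y + e_μ)` (CMP 98 (1985) p. 19, the contour `Γ_{c,x}`; (42) p. 23). They transform
   COVARIANTLY, `U^g(Γ_{c,x}) = g(c₋) U(Γ_{c,x}) g(c₊)⁻¹` (`contourVar_gaugeTransform`; CMP 98 p. 24).
3. **Block means and the hard averaging.** Bałaban's one-step average (CMP 98 (1985) (42) p. 23) is
   `Ū_c = exp[ L^{-d} ∑_{x ∈ B(c₋)} log( U(Γ_{c,x}) U(c)⁻¹ ) ] U(c)`, `U(c) = U(Γ_{c,c₋})` the straight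
   transporter, `log` the principal spectral logarithm of a unitary matrix ((22) p. 21): a function of
   the family `(U(Γ_{c,x}))_x` alone which is EQUIVARIANT under `w ↦ g w h⁻¹` (this is his verification
   of the covariance condition (11), p. 24: the logarithms are "unitarily equivalent with the same
   unitary operator `u(c₋)`"). We abstract exactly this: a `BlockMean G ι` is a measurable map
   `(ι → G) → G` equivariant under simultaneous left and right translation (CMP 119 (1988) p. 243
   (0.1): "we may take any averaging operation satisfying several general properties"; CMP 98 p. 20:
   "the analysis … can be easily extended to other definitions of averaging operations satisfying the
   requirements postulated in this introduction"), and define the hard averaging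
   `link N b m U (y, μ) = m.mean (v ↦ U(Γ_{(y,μ), corner y + v}))`. PROVED for every block mean:
   measurability (`measurable_link`), gauge covariance `link (U^g) = (link U)^{g ∘ corner}`
   (`link_gaugeTransform`, Bałaban's (11)), and locality (`link_dependsOn`: the block link at `(y, μ)`
   reads only fine links based at sites whose cube corner is within torus `ℓ∞`-distance `2b` of
   `corner y` — Bałaban p. 24: "depends only on the bond variables `U_b` for
   `b ⊂ B(c₋) ∪ B(c₊)`"). The closed-form inhabitant `BlockMean.rep v₀` (evaluation at one offset)
   gives at `v₀ = 0` the straight transporter between consecutive corners (`link_rep_zero`), i.e. the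
   tree's `GaugeBlockAveraging.axial` extended to `b ∤ N`.
4. **The soft step and the bundle** `BalabanSoftAveraging d G N b`: the hard data above together with a
   continuous central probability density `p` on `G` (w.r.t. the tree's `haarProbability G`), with
   the constructors `ofBlockMean` (any block mean, any such density), `ofHeatKernel` (density
   `p_t`, `t > 0`, of a heat kernel in the sense of the tree's hypothesis structure
   `IsGroupHeatKernel`, file `QuantumLattice/HeatKernelGroup`: continuity, positivity, normalisation
   and centrality are its fields `continuous`, `nonneg`, `integral_eq_one`, `central`) and `straight`
   (`BlockMean.rep 0` + heat kernel). Its fields are, for `d = 4`, `G = SU(3)`, literally those of the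
   line's hypothesis structure `SoftScheme N b` (`Summits/QuantumFields/QCD/Cruxes/RobustYangMills/
   Lines/soft-absorption-balaban-cone.lean`), which a Theorems file instantiates field by field.

## Design choices and faithfulness flags

* **Ragged seam.** Bałaban works on `L^k`-lattices (`b ∣ N`); the requesting line lives on odd tori
  `2S+1` with `b = ⌊ℓ₀/a_k⌋`. For `b ∣ N` items 1–3 are his (42) verbatim up to the choice of mean; for
  `b ∤ N` the straight piece of the contour has length `width(y, μ) ≤ b` (so that it ends at the same
  offset `v` in the next block, also through the seam, where `x + width e_μ` wraps around the torus),
  and the offsets `v` range over the full box `{0,…,b-1}^d` for every block (for the ragged block the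
  sites `corner y + v` then overrun it — all statements proved here hold regardless). This extension
  is ours, forced by the consumer; nothing in it is attributed to the source. [folklore]
* **The exp/log mean is NOT constructed here.** It needs the principal logarithm of a unitary matrix
  as a measurable conjugation-equivariant map into the Lie algebra and `exp` back into `G` (for
  `SU(N)`: tracelessness of `log` near `1`); Mathlib (pinned) has `Matrix.exp` but no matrix
  logarithm. `BlockMean` isolates exactly this missing piece: an `SU(N)` exp/log block mean, once
  built, is ONE more inhabitant of `BlockMean` and every theorem of this file applies to it unchanged.
  TODO(general form): `BlockMean.balabanExpLog : BlockMean SU(N) ι` on small fields, CMP 98 (42).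
* **`b = 0` is excluded** (`[NeZero b]`): the offset box `{0,…,b-1}^d` is empty and no equivariant
  mean exists on it; at `b = 0` the tree's `blockCorner 0` collapses the torus to one block anyway. A
  consumer indexing schemes by `b_k = ⌊ℓ₀/a_k⌋` uses `max 1 b_k`.
* **Locality radius.** We prove the consumer's form (cube corners within `2b` of `corner y` in each
  coordinate, forward or backward on the torus), slightly weaker than Bałaban's two-block statement;
  the sites actually read are `corner y + u`, `0 ≤ u_i ≤ 2b - 1`.
* **No soft step in the literature.** Bałaban's renormalization transformation uses the δ-function
  `δ(V Ū⁻¹)` (CMP 98 (10)); replacing it by a heat-kernel density `p_t(V Ū⁻¹)` is the consumer's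
  device. This file only PACKAGES a density with the four properties the consumer lists; it makes no
  claim about the resulting renormalization group.
* NOT here: Bałaban's regularity Propositions 1–2 (CMP 98 (51), (54)), analyticity on the regular
  domain (Sect. E), the `k`-th order composition formula (43) (iteration is re-instantiation at block
  size `b^k`), averaging of gauge transformations (Sect. F); an `SU(N)` heat kernel (the tree's
  `IsGroupHeatKernel` has no `SU(N)` inhabitant; `ofHeatKernel` is conditional on one).

## Mathlib status

Mathlib (pinned) has no lattice gauge theory. Used verbatim: `ZMod.val` arithmetic, `List.count`,
`DependsOn`, `Measurable` pi-lemmas, `Pi.single`. Everything lattice-side is the tree's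
(`ConstructiveQFTWave0`: `Site`, `Edge`, `GaugeConfig`, `gaugeTransform`, `haarProbability`;
`QuantumLattice/WilsonFermionBlockAveraging`: `pathEdges`, `pathEnd`, `transport`,
`transport_gaugeTransform`; `QuasiLocalGaugePerturbation`: `blockCorner`, `blockCorners`,
`IsBlockAligned`; `BlockScaleEffectivePerturbation`: `measurable_transport`;
`QuantumLattice/HeatKernelGroup`: `IsGroupHeatKernel`).

## References

* T. Bałaban, *Averaging operations for lattice gauge theories*, CMP 98 (1985) 17–51 (held
  `paper:doi-10-1007-bf01211042`): p. 17 (2) (blocks labelled by corners); p. 19 (10)–(11)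
  (renormalization transformation, covariance condition), (14)–(15) and the contour `Γ_{c,x}`;
  p. 21 (22) (spectral logarithm); p. 23 (42) (one-step averaging), p. 24 (43) (`k`-th order),
  locality remark and verification of (11). [Balaban1985Averaging]
* T. Bałaban, CMP 95 (1984) 17–40, §1 (1.4)–(1.7) (straight-line transporters `Γ_{y,x}`, gauge
  covariance of transporters; through the tree's `transport_gaugeTransform`). [Balaban1984Propagators]
* T. Bałaban, CMP 119 (1988) 243–285, p. 243 (0.1) ("any averaging operation satisfying several
  general properties"). [Balaban1988Convergent]
* E. M. Stein, *Topics in Harmonic Analysis* (1970), Ch. II §2 (heat semigroup on a compact group;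
  through the tree's `IsGroupHeatKernel`). [Stein1970]
-/

noncomputable section

open MeasureTheory Filter Finset
open Literature.MathematicalPhysics.QuantumLattice

namespace Literature.MathematicalPhysics.QuantumFieldTheory

namespace BalabanAveraging

variable {d N b : ℕ} {G : Type*}

/-! ### Equivariant block means -/

/-- A **block mean** on the group `G` over the index type `ι` (the offsets of the sites of a block):
a measurable map `mean : (ι → G) → G` which is EQUIVARIANT under simultaneous left and right
translation, `mean (g w h⁻¹) = g (mean w) h⁻¹` — the abstract form of Bałaban's one-step average
`Ū_c = exp[L^{-d} ∑_x log(U(Γ_{c,x}) U(c)⁻¹)] U(c)` (CMP 98 (1985) (42) p. 23, with `U(c) = w₀` the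
value at the corner offset), whose equivariance is his verification of the covariance condition (11)
(p. 24); CMP 119 (1988) p. 243 (0.1): "we may take any averaging operation satisfying several general
properties". The exp/log mean itself is not constructed in this file (no matrix logarithm in
Mathlib); `BlockMean.rep` is the closed-form inhabitant. [cite: Balaban1985Averaging, (42) p. 23 and (11) p. 19, p. 24] -/
structure BlockMean (G : Type*) [Group G] [MeasurableSpace G] (ι : Type*) where
  /-- the mean of a family of group elements -/
  mean : (ι → G) → G
  /-- equivariance under simultaneous left and right translation -/
  mean_conj : ∀ (g h : G) (w : ι → G), mean (fun i => g * w i * h⁻¹) = g * mean w * h⁻¹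
  /-- measurability (product σ-algebra on `ι → G`) -/
  measurable_mean : Measurable mean

namespace BlockMean

variable [Group G] [MeasurableSpace G] {ι : Type*}

/-- The **representative mean**: evaluation at one fixed offset `i₀` (trivially equivariant and
measurable). At the corner offset it turns Bałaban's averaging into the straight transporter between
consecutive block corners (`link_rep_zero`), the decimation-type blocking of the tree's
`GaugeBlockAveraging.axial`. [folklore] -/
def rep (i₀ : ι) : BlockMean G ι where
  mean w := w i₀
  mean_conj _ _ _ := rfl
  measurable_mean := measurable_pi_apply i₀

/-- The representative mean evaluates at its offset. [folklore] -/
@[simp] theorem rep_mean (i₀ : ι) (w : ι → G) : (rep i₀ : BlockMean G ι).mean w = w i₀ := rfl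

end BlockMean

/-! ### Block geometry at block size `b` on the torus of side `N` -/

variable (N b) in
/-- The side of the block torus: `⌈N / b⌉` blocks of side `b` per direction, the last one ragged when
`b ∤ N` (written `(N + b - 1) / b`). [folklore] -/
def blockSide : ℕ := (N + b - 1) / b

/-- There is at least one block (`N, b ≥ 1`). [folklore] -/
theorem blockSide_pos [NeZero N] [NeZero b] : 0 < blockSide N b :=
  Nat.div_pos (by have := NeZero.pos N; omega) (NeZero.pos b)

/-- Instance form of `blockSide_pos`, so that `Site d (blockSide N b)` is a finite torus. [folklore] -/
instance [NeZero N] [NeZero b] : NeZero (blockSide N b) := ⟨blockSide_pos.ne'⟩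

/-- `N ≤ ⌈N/b⌉ · b`: the blocks cover the torus. [folklore] -/
theorem le_blockSide_mul [NeZero b] : N ≤ blockSide N b * b := by
  have hb := NeZero.pos b
  have h1 := Nat.div_add_mod' (N + b - 1) b
  have h2 := Nat.mod_lt (N + b - 1) hb
  unfold blockSide
  omega

/-- `(⌈N/b⌉ - 1) · b < N`: the last block is non-empty. [folklore] -/
theorem pred_blockSide_mul_lt [NeZero N] [NeZero b] : (blockSide N b - 1) * b < N := by
  have hN := NeZero.pos N
  have h1 := Nat.div_mul_le_self (N + b - 1) b
  have h2 : 0 < blockSide N b := blockSide_pos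
  unfold blockSide at h2 ⊢
  rw [Nat.sub_one_mul]
  omega

/-- Block indices `k < ⌈N/b⌉` have corners `k b < N` inside the torus. [folklore] -/
theorem mul_lt_of_lt_blockSide [NeZero N] [NeZero b] {k : ℕ} (hk : k < blockSide N b) : k * b < N :=
  lt_of_le_of_lt (Nat.mul_le_mul_right b (Nat.le_sub_one_of_lt hk)) pred_blockSide_mul_lt

/-- Conversely a corner `k b < N` has block index `k < ⌈N/b⌉`. [folklore] -/
theorem lt_blockSide_of_mul_lt [NeZero b] {k : ℕ} (hk : k * b < N) : k < blockSide N b :=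
  Nat.lt_of_mul_lt_mul_right (lt_of_lt_of_le hk le_blockSide_mul)

/-- For `N = b S` (Bałaban's case `b ∣ N`) there are exactly `S` blocks per direction. [folklore] -/
theorem blockSide_mul [NeZero b] (S : ℕ) : blockSide (b * S) b = S := by
  have hb := NeZero.pos b
  unfold blockSide
  rw [Nat.mul_comm b S, show S * b + b - 1 = b - 1 + S * b by omega, Nat.add_mul_div_right _ _ hb,
    Nat.div_eq_of_lt (Nat.sub_one_lt_of_le hb le_rfl), zero_add]

variable (N b) in
/-- The **base corner** `b y = (b y₁, …, b y_d)` (on representatives `yᵢ ∈ {0,…,⌈N/b⌉-1}`) of the block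
labelled by the block-torus site `y`: Bałaban's blocks `B(y) = {x : y_μ ≤ x_μ < y_μ + Lη}` are
labelled by their smallest corner (CMP 98 (1985) p. 17 (2)); this is the label of the tree's cube
`blockCorner b` (file `QuasiLocalGaugePerturbation`). [cite: Balaban1985Averaging, p. 17 (2)] -/
def corner (y : Site d (blockSide N b)) : Site d N :=
  fun i => (((y i).val * b : ℕ) : ZMod N)

/-- The representative of a corner coordinate is `yᵢ b < N`. [folklore] -/
theorem val_corner [NeZero N] [NeZero b] (y : Site d (blockSide N b)) (i : Fin d) :
    (corner N b y i).val = (y i).val * b :=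
  ZMod.val_natCast_of_lt (mul_lt_of_lt_blockSide (ZMod.val_lt (y i)))

/-- Distinct block sites have distinct corners. [folklore] -/
theorem corner_injective [NeZero N] [NeZero b] : Function.Injective (corner (d := d) N b) := by
  intro y y' h
  funext i
  have hi := congrArg (fun z : Site d N => (z i).val) h
  simp only [val_corner] at hi
  exact ZMod.val_injective _ (Nat.eq_of_mul_eq_mul_right (NeZero.pos b) hi)

/-- Corners are block aligned. [folklore] -/
theorem isBlockAligned_corner [NeZero N] [NeZero b] (y : Site d (blockSide N b)) :
    IsBlockAligned b (corner N b y) :=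
  fun i => by rw [val_corner]; exact Dvd.intro_left _ rfl

/-- Corners are labels of the tree's cubes of side `b`. [folklore] -/
theorem corner_mem_blockCorners [NeZero N] [NeZero b] (y : Site d (blockSide N b)) :
    corner N b y ∈ blockCorners b :=
  mem_blockCorners_iff.2 (isBlockAligned_corner y)

/-- A corner is its own cube corner. [folklore] -/
@[simp] theorem blockCorner_corner [NeZero N] [NeZero b] (y : Site d (blockSide N b)) :
    blockCorner b (corner N b y) = corner N b y :=
  blockCorner_eq_self_iff.2 (isBlockAligned_corner y)

/-- Every cube label of the tree is the corner of a block site: `corner` is ONTO `blockCorners b`. [folklore] -/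
theorem exists_corner_eq [NeZero N] [NeZero b] {x : Site d N} (hx : x ∈ blockCorners b) :
    ∃ y : Site d (blockSide N b), corner N b y = x := by
  rw [mem_blockCorners_iff] at hx
  refine ⟨fun i => (((x i).val / b : ℕ) : ZMod (blockSide N b)), funext fun i => ?_⟩
  have hdiv : (x i).val / b * b = (x i).val := Nat.div_mul_cancel (hx i)
  have hlt : (x i).val / b < blockSide N b :=
    lt_blockSide_of_mul_lt (by rw [hdiv]; exact ZMod.val_lt _)
  simp only [corner, ZMod.val_natCast_of_lt hlt, hdiv, ZMod.natCast_zmod_val]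

variable (N b) in
/-- The **side of block `y` in direction `i`**: `b`, except for the ragged last block of side
`N - (⌈N/b⌉ - 1) b` when `b ∤ N`. [folklore] -/
def width (y : Site d (blockSide N b)) (i : Fin d) : ℕ :=
  min b (N - (y i).val * b)

/-- Block sides are at most `b`. [folklore] -/
theorem width_le (y : Site d (blockSide N b)) (i : Fin d) : width N b y i ≤ b :=
  min_le_left _ _

/-- Block sides are positive. [folklore] -/
theorem width_pos [NeZero N] [NeZero b] (y : Site d (blockSide N b)) (i : Fin d) : 0 < width N b y i :=
  lt_min (NeZero.pos b) (Nat.sub_pos_of_lt (mul_lt_of_lt_blockSide (ZMod.val_lt (y i))))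

/-- When `b ∣ N` every block has side `b` — no ragged block: Bałaban's setting, in which the contour
variables and the hard averaging below are his (42) verbatim up to the choice of mean. [folklore] -/
theorem width_eq_of_dvd [NeZero N] [NeZero b] (h : b ∣ N) (y : Site d (blockSide N b)) (i : Fin d) :
    width N b y i = b := by
  obtain ⟨S, rfl⟩ := h
  have hk : (y i).val < S := by simpa only [blockSide_mul] using ZMod.val_lt (y i)
  have h1 : ((y i).val + 1) * b ≤ S * b := Nat.mul_le_mul_right b hk
  rw [Nat.add_one_mul, Nat.mul_comm S b] at h1
  unfold width
  apply min_eq_left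
  omega

/-- The next site in direction `i` has `i`-th coordinate `+ 1`. [folklore] -/
theorem shift_apply_same {L : ℕ} (x : Site d L) (i : Fin d) : x.shift i i = x i + 1 := by
  simp [Site.shift]

/-- The next site in direction `i` has the same other coordinates. [folklore] -/
theorem shift_apply_of_ne {L : ℕ} (x : Site d L) {i j : Fin d} (h : j ≠ i) : x.shift i j = x j := by
  simp [Site.shift, Pi.single_eq_of_ne h]

/-- **Consecutive corners**: on the torus, the corner of the next block in direction `μ` is the corner
of `y` moved forward by the side of block `y` — `b` in the bulk, the ragged side across the seam
(where `⌈N/b⌉ e_μ ≡ 0` on the block torus and `N e_μ ≡ 0` on the fine torus). [folklore] -/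
theorem corner_shift_eq [NeZero N] [NeZero b] (y : Site d (blockSide N b)) (μ : Fin d) :
    corner N b (y.shift μ) = corner N b y + Pi.single μ ((width N b y μ : ℕ) : ZMod N) := by
  funext i
  by_cases hi : i = μ
  · subst hi
    set k := (y i).val with hk
    have hkS : k < blockSide N b := ZMod.val_lt (y i)
    have hy : (y.shift i) i = ((k + 1 : ℕ) : ZMod (blockSide N b)) := by
      rw [shift_apply_same, Nat.cast_add, Nat.cast_one, hk, ZMod.natCast_zmod_val]
    simp only [corner, Pi.add_apply, Pi.single_eq_same, width]
    by_cases h1 : k + 1 < blockSide N b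
    · have hlt : (k + 1) * b < N := mul_lt_of_lt_blockSide h1
      have hw : min b (N - k * b) = b := min_eq_left (by rw [Nat.add_one_mul] at hlt; omega)
      rw [hy, ZMod.val_natCast_of_lt h1, ← hk, hw, Nat.add_one_mul, Nat.cast_add]
    · have hkS' : k + 1 = blockSide N b := by omega
      have hle : N ≤ k * b + b := by
        have := le_blockSide_mul (N := N) (b := b)
        rw [← hkS', Nat.add_one_mul] at this
        exact this
      have hkb : k * b ≤ N := (mul_lt_of_lt_blockSide hkS).le
      have hw : min b (N - k * b) = N - k * b := min_eq_right (by omega)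
      rw [hy, hkS', ZMod.natCast_self, ZMod.val_zero, zero_mul, Nat.cast_zero, ← hk, hw,
        ← Nat.cast_add, Nat.add_sub_cancel' hkb, ZMod.natCast_self]
  · rw [Pi.add_apply, Pi.single_eq_of_ne hi, add_zero]
    simp only [corner, shift_apply_of_ne y hi]

/-- The forward torus distance between consecutive corners is at most `b` (`≤ 2b` is the consumer's
form), in every coordinate. [folklore] -/
theorem val_corner_shift_sub_le [NeZero N] [NeZero b] (y : Site d (blockSide N b)) (μ i : Fin d) :
    ((corner N b (y.shift μ)) i - (corner N b y) i).val ≤ 2 * b := by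
  rw [corner_shift_eq, Pi.add_apply, add_sub_cancel_left]
  by_cases hi : i = μ
  · subst hi
    rw [Pi.single_eq_same, ZMod.val_natCast]
    exact (Nat.mod_le _ _).trans ((width_le y i).trans (Nat.le_mul_of_pos_left b two_pos))
  · rw [Pi.single_eq_of_ne hi, ZMod.val_zero]
    exact Nat.zero_le _

/-! ### Taxi paths, sites visited by a path -/

/-- The coordinate-ordered **taxi path** with `v₀` steps in direction `0`, then `v₁` steps in
direction `1`, …: the tree's fixed choice (`torusBlockPath`, the case `b ∣ N`) of Bałaban's contour
`Γ_{y,x}` from the corner `y` of a block to its site `x = y + v` (CMP 98 (1985) p. 19). [folklore] -/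
def taxi (v : Fin d → ℕ) : List (Fin d) :=
  ((List.finRange d).map fun i => List.replicate (v i) i).flatten

/-- The taxi path with offsets `v` from `c` ends at `c + v`. [folklore] -/
theorem pathEnd_taxi (c : Site d N) (v : Fin d → ℕ) :
    pathEnd c (taxi v) = c + fun i => ((v i : ℕ) : ZMod N) := by
  rw [pathEnd_eq_add]
  congr 1
  rw [taxi, List.map_flatten, List.sum_flatten, List.map_map, List.map_map, ← Fin.sum_univ_def]
  funext j
  simp only [Function.comp_def, List.map_replicate, List.sum_replicate, Finset.sum_apply,
    Pi.smul_apply, Pi.single_apply, smul_ite, smul_zero, Nat.smul_one_eq_cast]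
  rw [Finset.sum_ite_eq, if_pos (Finset.mem_univ j)]

/-- The straight path of `n` steps in direction `μ` from `c` ends at `c + n e_μ`. [folklore] -/
theorem pathEnd_replicate (c : Site d N) (n : ℕ) (μ : Fin d) :
    pathEnd c (List.replicate n μ) = c + Pi.single μ ((n : ℕ) : ZMod N) := by
  rw [pathEnd_eq_add, List.map_replicate, List.sum_replicate]
  congr 1
  funext j
  simp only [Pi.smul_apply, Pi.single_apply, smul_ite, smul_zero, Nat.smul_one_eq_cast]

/-- The taxi path takes exactly `vᵢ` steps in direction `i`. [folklore] -/
theorem count_taxi (v : Fin d → ℕ) (i : Fin d) : (taxi v).count i = v i := by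
  have key : ∀ L : List (Fin d), ((L.map fun j => List.replicate (v j) j).flatten).count i =
      (L.map fun j => if j = i then v j else 0).sum := by
    intro L
    induction L with
    | nil => simp
    | cons j L ih =>
      simp only [List.map_cons, List.flatten_cons, List.count_append, ih, List.sum_cons]
      congr 1
      by_cases h : j = i
      · subst h; simp
      · simp [h, List.count_replicate]
  rw [taxi, key, ← Fin.sum_univ_def (fun j => if j = i then v j else 0), Finset.sum_ite_eq',
    if_pos (Finset.mem_univ i)]

/-- The empty path has no edges (definitional unfolding of the tree's `pathEdges`). [folklore] -/
theorem pathEdges_nil' (c : Site d N) : pathEdges c ([] : List (Fin d)) = [] := rfl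

/-- The edges of a path are its first edge followed by the edges of the rest (definitional
unfolding of the tree's `pathEdges`). [folklore] -/
theorem pathEdges_cons' (c : Site d N) (i : Fin d) (is : List (Fin d)) :
    pathEdges c (i :: is) = (c, i) :: pathEdges (c.shift i) is := rfl

/-- **Sites visited by a lattice path**: every edge of the path from `c` with steps `is` is based at
`c + u` for an offset `u` with `uᵢ ≤ #{steps in direction i}`. [folklore] -/
theorem exists_offset_of_mem_pathEdges {c : Site d N} {is : List (Fin d)} {e : Edge d N}
    (he : e ∈ pathEdges c is) :
    ∃ u : Fin d → ℕ, (∀ i, u i ≤ is.count i) ∧ e.1 = c + fun i => ((u i : ℕ) : ZMod N) := by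
  induction is generalizing c with
  | nil => simp [pathEdges_nil'] at he
  | cons j is ih =>
    rw [pathEdges_cons', List.mem_cons] at he
    rcases he with rfl | he
    · exact ⟨0, fun _ => Nat.zero_le _, by funext i; simp⟩
    · obtain ⟨u, hu, hux⟩ := ih he
      refine ⟨fun i => u i + if i = j then 1 else 0, fun i => ?_, ?_⟩
      · rw [List.count_cons]
        by_cases h : i = j
        · subst h; simpa using hu i
        · have hne : (j == i) = false := beq_eq_false_iff_ne.2 (Ne.symm h)
          simpa [h, hne] using hu i
      · rw [hux]
        funext i
        simp only [Site.shift, Pi.add_apply, Pi.single_apply, Nat.cast_add, Nat.cast_ite, Nat.cast_one,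
          Nat.cast_zero]
        ring

/-- A transporter reads only the links of its path. [folklore] -/
theorem transport_congr [Monoid G] {U U' : GaugeConfig d N G} {c : Site d N} {is : List (Fin d)}
    (h : ∀ e ∈ pathEdges c is, U e = U' e) : transport U c is = transport U' c is := by
  unfold transport
  rw [List.map_congr_left h]

/-- **Nearby sites have nearby cube corners**: a site `z = c + u` with `0 ≤ uᵢ ≤ 2b` has its cube
corner `blockCorner b z` within torus distance `2b` of `c` in every coordinate, forward or backward
(the cube corner moves `z` back by `zᵢ mod b < b`). [folklore] -/
theorem blockCorner_near [NeZero N] (hb : 0 < b) (c z : Site d N) (u : Fin d → ℕ)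
    (hu : ∀ i, u i ≤ 2 * b) (hz : ∀ i, z i = c i + ((u i : ℕ) : ZMod N)) (i : Fin d) :
    ((blockCorner b z) i - c i).val ≤ 2 * b ∨ (c i - (blockCorner b z) i).val ≤ 2 * b := by
  set r := (z i).val % b with hr
  have hrb : r < b := Nat.mod_lt _ hb
  have hbc : blockCorner b z i = c i + ((u i : ℕ) : ZMod N) - ((r : ℕ) : ZMod N) := by
    rw [← hz i, eq_sub_iff_add_eq]
    change (((z i).val / b * b : ℕ) : ZMod N) + ((r : ℕ) : ZMod N) = z i
    rw [← Nat.cast_add, hr, Nat.div_add_mod', ZMod.natCast_zmod_val]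
  by_cases hur : r ≤ u i
  · left
    rw [hbc, add_sub_assoc, add_sub_cancel_left, ← Nat.cast_sub hur, ZMod.val_natCast]
    exact (Nat.mod_le _ _).trans ((Nat.sub_le _ _).trans (hu i))
  · right
    rw [hbc, add_sub_assoc, sub_add_cancel_left, neg_sub, ← Nat.cast_sub (le_of_not_ge hur),
      ZMod.val_natCast]
    exact (Nat.mod_le _ _).trans (by omega)

/-! ### Bałaban's contour variables and the hard averaging -/

variable [Group G]

variable (N b) in
/-- **Bałaban's contour variable** `U(Γ_{c,x})` of the block-torus edge `c = (y, μ)` and the offset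
`v ∈ {0,…,b-1}^d`, `x = corner y + v`: the parallel transporter from the corner `c₋ = corner y` along
the taxi path to `x`, then straight in direction `μ` for `width(y, μ)` steps (to the site with the same
offset in the next block, also across the ragged seam), then BACK along the taxi path of the next
block to its corner `c₊ = corner (y + e_μ)` (CMP 98 (1985) p. 19: `Γ_{c,x} = Γ_{c₋,x} ∪ [x, x(c)] ∪
Γ_{x(c),c₊}`; the argument of the logarithm in (42), p. 23). For `v = 0` it is the straight
transporter `U(c)`. [cite: Balaban1985Averaging, p. 19 and (42) p. 23] -/
def contourVar (U : GaugeConfig d N G) (e : Edge d (blockSide N b)) (v : Fin d → Fin b) : G :=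
  transport U (corner N b e.1) (taxi fun i => (v i : ℕ)) *
    transport U (corner N b e.1 + fun i => ((v i : ℕ) : ZMod N)) (List.replicate (width N b e.1 e.2) e.2) *
      (transport U (corner N b (e.1.shift e.2)) (taxi fun i => (v i : ℕ)))⁻¹

variable (N b) in
/-- **The hard block averaging** of the gauge field at block size `b` through the block mean `m`:
the block link at `(y, μ)` is the mean over the offsets `v` of the contour variables
`U(Γ_{(y,μ), corner y + v})` — Bałaban's `Ū_c` (CMP 98 (1985) (42) p. 23) for his exp/log mean, the
straight transporter between consecutive corners for `BlockMean.rep 0`. [cite: Balaban1985Averaging, (42) p. 23] -/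
def link [MeasurableSpace G] (m : BlockMean G (Fin d → Fin b)) (U : GaugeConfig d N G) :
    GaugeConfig d (blockSide N b) G :=
  fun e => m.mean (contourVar N b U e)

/-- With the representative mean at the corner offset the block link is the straight transporter of
`width(y, μ)` steps from `corner y` (to `corner (y + e_μ)`): the tree's `GaugeBlockAveraging.axial`
at arbitrary `(N, b)`. [folklore] -/
theorem link_rep_zero [MeasurableSpace G] [NeZero b] (U : GaugeConfig d N G) (e : Edge d (blockSide N b)) :
    link N b (BlockMean.rep 0) U e =
      transport U (corner N b e.1) (List.replicate (width N b e.1 e.2) e.2) := by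
  have h0 : (taxi fun i : Fin d => (((0 : Fin d → Fin b) i : Fin b) : ℕ)) = [] := by
    simp [taxi]
  have h0' : (corner N b e.1 + fun i : Fin d => ((((0 : Fin d → Fin b) i : Fin b) : ℕ) : ZMod N)) =
      corner N b e.1 := by
    funext i; simp
  simp only [link, BlockMean.rep_mean, contourVar, h0, h0', transport_nil, one_mul, inv_one, mul_one]

/-- **Gauge covariance of the contour variables**: `U^g(Γ_{c,x}) = g(c₋) U(Γ_{c,x}) g(c₊)⁻¹`
(telescoping along the three pieces; Bałaban CMP 98 (1985) p. 24). [cite: Balaban1985Averaging, p. 24] -/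
theorem contourVar_gaugeTransform [NeZero N] [NeZero b] (g : Site d N → G) (U : GaugeConfig d N G)
    (e : Edge d (blockSide N b)) (v : Fin d → Fin b) :
    contourVar N b (gaugeTransform g U) e v =
      g (corner N b e.1) * contourVar N b U e v * (g (corner N b (e.1.shift e.2)))⁻¹ := by
  have hx : corner N b e.1 + Pi.single e.2 ((width N b e.1 e.2 : ℕ) : ZMod N) +
      (fun i => (((v i : Fin b) : ℕ) : ZMod N)) =
        (corner N b e.1 + fun i => (((v i : Fin b) : ℕ) : ZMod N)) +
          Pi.single e.2 ((width N b e.1 e.2 : ℕ) : ZMod N) := add_right_comm _ _ _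
  simp only [contourVar, transport_gaugeTransform, pathEnd_taxi, pathEnd_replicate, corner_shift_eq, hx]
  group

/-- **Gauge covariance of the hard averaging** (Bałaban's condition (11), CMP 98 (1985) p. 19,
verified for (42) on p. 24): `link (U^g) = (link U)^{g ∘ corner}` — the block field transforms under
the gauge transformation restricted to the block corners. [cite: Balaban1985Averaging, (11) p. 19] -/
theorem link_gaugeTransform [MeasurableSpace G] [NeZero N] [NeZero b] (m : BlockMean G (Fin d → Fin b)) (g : Site d N → G)
    (U : GaugeConfig d N G) :
    link N b m (gaugeTransform g U) = gaugeTransform (g ∘ corner N b) (link N b m U) := by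
  funext e
  change m.mean (contourVar N b (gaugeTransform g U) e) =
    g (corner N b e.1) * m.mean (contourVar N b U e) * (g (corner N b (e.1.shift e.2)))⁻¹
  rw [← m.mean_conj]
  congr 1
  funext v
  exact contourVar_gaugeTransform g U e v

/-- The contour variables are measurable functions of the fine configuration. [folklore] -/
@[fun_prop] theorem measurable_contourVar [MeasurableSpace G] [MeasurableMul₂ G] [MeasurableInv G]
    (e : Edge d (blockSide N b)) (v : Fin d → Fin b) :
    Measurable fun U : GaugeConfig d N G => contourVar N b U e v := by
  unfold contourVar
  fun_prop

/-- **Measurability of the hard averaging** (product σ-algebras). [folklore] -/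
theorem measurable_link [MeasurableSpace G] [MeasurableMul₂ G] [MeasurableInv G]
    (m : BlockMean G (Fin d → Fin b)) : Measurable (link N b m : GaugeConfig d N G → _) :=
  measurable_pi_lambda _ fun e =>
    m.measurable_mean.comp (measurable_pi_lambda _ fun v => measurable_contourVar e v)

/-- **Locality of the hard averaging** (Bałaban CMP 98 (1985) p. 24: `Ū_c` "depends only on the bond
variables `U_b` for `b ⊂ B(c₋) ∪ B(c₊)`"; here in the consumer's form): the block link at `(y, μ)`
depends only on the fine links based at sites whose cube corner is within torus distance `2b` of
`corner y` in every coordinate. [cite: Balaban1985Averaging, p. 24] -/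
theorem link_dependsOn [MeasurableSpace G] [NeZero N] [NeZero b] (m : BlockMean G (Fin d → Fin b))
    (e : Edge d (blockSide N b)) :
    DependsOn (fun U : GaugeConfig d N G => link N b m U e)
      {e' : Edge d N | ∀ i : Fin d, ((blockCorner b e'.1) i - (corner N b e.1) i).val ≤ 2 * b ∨
        ((corner N b e.1) i - (blockCorner b e'.1) i).val ≤ 2 * b} := by
  intro U U' h
  change m.mean (contourVar N b U e) = m.mean (contourVar N b U' e)
  congr 1
  funext v
  have hb : 0 < b := NeZero.pos b
  have hv : ∀ i, ((v i : Fin b) : ℕ) ≤ b - 1 := fun i => Nat.le_sub_one_of_lt (v i).isLt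
  have hw : width N b e.1 e.2 ≤ b := width_le _ _
  -- the three pieces of the contour read only nearby links
  have h1 : transport U (corner N b e.1) (taxi fun i => (v i : ℕ)) =
      transport U' (corner N b e.1) (taxi fun i => (v i : ℕ)) := by
    refine transport_congr fun e' he' => h e' ?_
    obtain ⟨u, hu, hux⟩ := exists_offset_of_mem_pathEdges he'
    refine blockCorner_near hb _ _ u (fun i => ?_) (fun i => by rw [hux]; rfl)
    have := hu i; rw [count_taxi] at this; have := hv i; omega
  have h2 : transport U (corner N b e.1 + fun i => (((v i : Fin b) : ℕ) : ZMod N))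
      (List.replicate (width N b e.1 e.2) e.2) =
      transport U' (corner N b e.1 + fun i => (((v i : Fin b) : ℕ) : ZMod N))
        (List.replicate (width N b e.1 e.2) e.2) := by
    refine transport_congr fun e' he' => h e' ?_
    obtain ⟨u, hu, hux⟩ := exists_offset_of_mem_pathEdges he'
    refine blockCorner_near hb _ _ (fun i => (v i : ℕ) + u i) (fun i => ?_)
      (fun i => by rw [hux]; simp only [Pi.add_apply, Nat.cast_add]; ring)
    have hu' := (hu i).trans List.count_le_length
    rw [List.length_replicate] at hu'
    have := hv i
    omega
  have h3 : transport U (corner N b (e.1.shift e.2)) (taxi fun i => (v i : ℕ)) =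
      transport U' (corner N b (e.1.shift e.2)) (taxi fun i => (v i : ℕ)) := by
    refine transport_congr fun e' he' => h e' ?_
    obtain ⟨u, hu, hux⟩ := exists_offset_of_mem_pathEdges he'
    refine blockCorner_near hb _ _ (fun i => (if i = e.2 then width N b e.1 e.2 else 0) + u i)
      (fun i => ?_) (fun i => ?_)
    · have := hu i; rw [count_taxi] at this; have := hv i; split_ifs <;> omega
    · rw [hux, corner_shift_eq]
      simp only [Pi.add_apply, Pi.single_apply, Nat.cast_add, Nat.cast_ite, Nat.cast_zero]
      ring
  simp only [contourVar, h1, h2, h3]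

end BalabanAveraging

/-! ### The bundle: hard covariant averaging + soft last step -/

open BalabanAveraging

/-- **A Bałaban soft block-averaging scheme** of the `G`-gauge field on the torus `(ℤ/Nℤ)^d` at block
size `b`: a block torus of side `S'` whose sites label the cubes of side `b` bijectively and coherently
through their corners (`corner`, onto the tree's `blockCorners b`, consecutive corners within torus
distance `2b`); a measurable, gauge-COVARIANT (`link (U^g) = (link U)^{g ∘ corner}`, Bałaban's
condition (11)) and LOCAL hard block averaging `link` (Bałaban, CMP 98 (1985) (42); CMP 119 (1988)
(0.1)); and a SOFT LAST STEP, a continuous central probability density `p` on `G` with respect to the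
normalised Haar measure, with which a consumer smears each hard block link, `V(y,μ) ∼ p(V V̄⁻¹) dV`,
in place of the δ-function of Bałaban's transformation (10) (the smearing is the consumer's device,
not the source's). For `d = 4`, `G = SU(3)` the fields are literally those of the line's
hypothesis record `SoftScheme N b` (line `soft-absorption-balaban-cone`, crux `RobustYangMills`).
Inhabitants: `ofBlockMean`, `ofHeatKernel`, `straight`. [cite: Balaban1985Averaging, (10)–(11) p. 19 and (42) p. 23] -/
structure BalabanSoftAveraging (d : ℕ) (G : Type*) [Group G] [TopologicalSpace G] [IsTopologicalGroup G]
    [CompactSpace G] [MeasurableSpace G] [BorelSpace G] (N : ℕ) [NeZero N] (b : ℕ) where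
  /-- side of the block torus -/
  S' : ℕ
  /-- the block torus is non-degenerate -/
  S'_pos : 0 < S'
  /-- the hard covariant block averaging -/
  link : GaugeConfig d N G → GaugeConfig d S' G
  /-- the hard averaging is measurable -/
  measurable_link : Measurable link
  /-- the fine corner of the block labelled by a block-torus site -/
  corner : Site d S' → Site d N
  /-- distinct labels, distinct corners -/
  corner_injective : Function.Injective corner
  /-- corners are cube labels of the tree -/
  corner_mem : ∀ y, corner y ∈ blockCorners (d := d) (L := N) b
  /-- every cube label is a corner -/
  corner_surj : ∀ x ∈ blockCorners (d := d) (L := N) b, ∃ y, corner y = x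
  /-- consecutive corners are within forward torus distance `2b` -/
  corner_shift : ∀ (y : Site d S') (μ i : Fin d), ((corner (y.shift μ)) i - (corner y) i).val ≤ 2 * b
  /-- gauge covariance of the hard averaging -/
  link_gaugeTransform : ∀ (g : Site d N → G) (U : GaugeConfig d N G),
    link (gaugeTransform g U) = gaugeTransform (g ∘ corner) (link U)
  /-- locality of the hard averaging -/
  link_local : ∀ e : Edge d S', DependsOn (fun U => link U e)
    {e' : Edge d N | ∀ i : Fin d, ((blockCorner b e'.1) i - (corner e.1) i).val ≤ 2 * b ∨
      ((corner e.1) i - (blockCorner b e'.1) i).val ≤ 2 * b}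
  /-- the soft-step density -/
  p : G → ℝ
  /-- the density is continuous -/
  p_continuous : Continuous p
  /-- the density is non-negative -/
  p_nonneg : ∀ g, 0 ≤ p g
  /-- the density is normalised for the Haar probability measure -/
  p_integral : ∫ g, p g ∂(haarProbability G) = 1
  /-- the density is a class function -/
  p_central : ∀ g h, p (h * g * h⁻¹) = p g

namespace BalabanSoftAveraging

variable {d N b : ℕ} {G : Type*} [Group G] [TopologicalSpace G] [IsTopologicalGroup G] [CompactSpace G]
  [MeasurableSpace G] [BorelSpace G] [NeZero N]

/-- **Bałaban's averaging through a block mean, with a given soft density**: block torus of side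
`⌈N/b⌉`, corners `b y`, hard averaging `link N b m` (all structure fields are the theorems of
namespace `BalabanAveraging`), and any continuous central probability density `p`. [cite: Balaban1985Averaging, (42) p. 23] -/
def ofBlockMean [NeZero b] [MeasurableMul₂ G] [MeasurableInv G] (m : BlockMean G (Fin d → Fin b))
    (p : G → ℝ) (hpc : Continuous p) (hp0 : ∀ g, 0 ≤ p g) (hp1 : ∫ g, p g ∂(haarProbability G) = 1)
    (hpz : ∀ g h, p (h * g * h⁻¹) = p g) : BalabanSoftAveraging d G N b where
  S' := blockSide N b
  S'_pos := blockSide_pos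
  link := BalabanAveraging.link N b m
  measurable_link := BalabanAveraging.measurable_link m
  corner := BalabanAveraging.corner N b
  corner_injective := BalabanAveraging.corner_injective
  corner_mem := corner_mem_blockCorners
  corner_surj _ hx := exists_corner_eq hx
  corner_shift := val_corner_shift_sub_le
  link_gaugeTransform := BalabanAveraging.link_gaugeTransform m
  link_local := link_dependsOn m
  p := p
  p_continuous := hpc
  p_nonneg := hp0
  p_integral := hp1
  p_central := hpz

/-- **Bałaban's averaging through a block mean with a HEAT-KERNEL soft step** `p_t`, `t > 0`, for a
heat kernel `pk` of `G` in the sense of the tree's `IsGroupHeatKernel` (Stein 1970 Ch. II §2: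
continuity, positivity, normalisation, centrality of `p_t`). Conditional on such a `pk` (the tree has
no `SU(N)` inhabitant of `IsGroupHeatKernel`). [cite: Stein1970, Ch. II §2] -/
def ofHeatKernel [NeZero b] [MeasurableMul₂ G] [MeasurableInv G] (m : BlockMean G (Fin d → Fin b))
    {pk : ℝ → G → ℝ} (hp : IsGroupHeatKernel pk) {t : ℝ} (ht : 0 < t) : BalabanSoftAveraging d G N b :=
  ofBlockMean m (pk t) (hp.continuous ht) (hp.nonneg t ht) (hp.integral_eq_one t ht) (hp.central t ht)

/-- The **straight-transporter scheme with heat-kernel soft step**: the representative mean at the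
corner offset (block link = straight transporter `corner y → corner (y + e_μ)`, `link_rep_zero`),
smeared by `p_t`. [folklore] -/
def straight [NeZero b] [MeasurableMul₂ G] [MeasurableInv G] {pk : ℝ → G → ℝ} (hp : IsGroupHeatKernel pk)
    {t : ℝ} (ht : 0 < t) : BalabanSoftAveraging d G N b :=
  ofHeatKernel (BlockMean.rep 0) hp ht

/-- The block torus of `ofBlockMean` has side `⌈N/b⌉`. [folklore] -/
@[simp] theorem ofBlockMean_S' [NeZero b] [MeasurableMul₂ G] [MeasurableInv G] (m : BlockMean G (Fin d → Fin b))
    (p : G → ℝ) (hpc : Continuous p) (hp0 : ∀ g, 0 ≤ p g) (hp1 : ∫ g, p g ∂(haarProbability G) = 1)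
    (hpz : ∀ g h, p (h * g * h⁻¹) = p g) :
    (ofBlockMean (d := d) (N := N) m p hpc hp0 hp1 hpz).S' = blockSide N b := rfl

/-- The soft density of `ofHeatKernel` is `p_t`. [folklore] -/
@[simp] theorem ofHeatKernel_p [NeZero b] [MeasurableMul₂ G] [MeasurableInv G] (m : BlockMean G (Fin d → Fin b))
    {pk : ℝ → G → ℝ} (hp : IsGroupHeatKernel pk) {t : ℝ} (ht : 0 < t) :
    (ofHeatKernel (d := d) (N := N) m hp ht).p = pk t := rfl

/-- The block torus of a scheme is non-degenerate (instance form of `S'_pos`). [folklore] -/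
instance (𝔄 : BalabanSoftAveraging d G N b) : NeZero 𝔄.S' := ⟨𝔄.S'_pos.ne'⟩

end BalabanSoftAveraging

end Literature.MathematicalPhysics.QuantumFieldTheory
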